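import Mathlib
import Literature.Computability.AlgebraicComplexity.DepthThreeChasmAlgebra
import Summits.ValiantsHypothesis.ValiantsHypothesis.Theorems.NewtonTauWeak.Negative.Zonogon

/-!
# `NewtonTauWeak` (stmt-ValiantsHypothesis-5904), line `binomial-normal-form`: the duality + splitting step

Stub `stub_binomialStep` of the skeleton line `binomial-normal-form` for the crux
`Summit.ValiantsHypothesis.ValiantsHypothesis.Theses.NewtonUnitEquations.NewtonTauWeak`: a bound
`vert(Σ_{l<K} c_l Π_{j<N} (1 - ρ_{lj} X^{d_{lj}})) ≤ (K N + 2)^b` on the Newton vertices of sums of products of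
BINOMIALS gives the bound `vert(Σ_{i<k} c_i g_i^m) ≤ 2^{2 b m} (k t + 2)^{2 b}` on sums of `m`-th POWERS of
`t`-sparse bivariate polynomials.

The proof is the binomial normal form of a power (Gupta–Kamath–Kayal–Saptharishi, ECCC TR13-026, Lemmas 4.6–4.7,
all proved in `Literature/Computability/AlgebraicComplexity/DepthThreeChasmAlgebra.lean`):

* Saxena's duality (`DepthThreeChasm.duality`) applied to the TERMS `c_v X^v` (`v ∈ supp g`) of a `t`-sparse `g`:
  `g^m = Σ_{u ≤ m t} β_u Π_{v ∈ supp g} E_m(u c_v X^v)` with the truncated exponential `E_m`;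
* splitting over `ℂ` (`truncExp_eq_aeval`, `aeval_eq_leadingCoeff_mul_prod_roots`): `E_m(u c_v X^v) = G(X^v)` for a
  univariate `G` with `G(0) = 1`, `deg G ≤ m`, hence `G(X^v) = Π_{σ ∈ roots G} (1 - σ⁻¹ X^v)` (`≤ m` binomials);
* padding with the trivial binomial `1 - 0 · X^0 = 1` to exactly `N = t m` factors per product and re-indexing the
  `k (m t + 1)` products by `Fin (k (m t + 1))`;
* the arithmetic `k (m t + 1) t m + 2 ≤ 4^m (k t + 2)^2`.

Helper lemmas live in the sub-namespace `BinomialStep`; binomial products are carried around as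
`(L.map fun p => 1 - C p.1 * monomial p.2 1).prod` for a list `L` of (coefficient, exponent) pairs until the final
padding. Nothing here is specific to two variables except the types demanded by the stub.
-/

set_option linter.dupNamespace false

noncomputable section

open scoped BigOperators
open MvPolynomial
open Summit.ValiantsHypothesis.ValiantsHypothesis.Theorems.NewtonTauWeak.Negative (vert vert_le_card_support)
open Literature.Computability.AlgebraicComplexity.DepthThreeChasm

namespace Summit.ValiantsHypothesis.ValiantsHypothesis.Theorems.NewtonUnitEquationsNewtonTauWeak

namespace BinomialStep

/-! ### Splitting a univariate polynomial with constant term `1` into binomials `1 - σ⁻¹ ℓ` -/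

/-- Over `ℂ`, a univariate `G` with `G(0) = 1` evaluates in any `ℂ`-algebra as
`G(ℓ) = Π_{σ ∈ roots G} (1 - σ⁻¹ ℓ)`, and `#roots G = deg G` (GKKS TR13-026, proof of Lemma 4.7, normalised at the
constant term: `lc(G) Π_σ (-σ) = G(0) = 1` and no root vanishes). -/
theorem aeval_eq_prod_one_sub {R : Type*} [CommRing R] [Algebra ℂ R] (G : Polynomial ℂ)
    (h0 : G.coeff 0 = 1) (ℓ : R) :
    Polynomial.aeval ℓ G = (G.roots.map fun σ => 1 - algebraMap ℂ R σ⁻¹ * ℓ).prod ∧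
      G.roots.card = G.natDegree := by
  obtain ⟨h1, hcard⟩ := aeval_eq_leadingCoeff_mul_prod_roots (K := ℂ) G ℓ
  obtain ⟨h2, -⟩ := aeval_eq_leadingCoeff_mul_prod_roots (K := ℂ) (R := ℂ) G 0
  refine ⟨?_, hcard⟩
  have hG0 : G ≠ 0 := by
    rintro rfl
    simp at h0
  -- `G(0) = 1`, so `lc(G) · Π_σ (-σ) = 1`
  have h3 : Polynomial.aeval (0 : ℂ) G = 1 := by
    rw [← Polynomial.coeff_zero_eq_aeval_zero]; exact h0
  simp only [Algebra.algebraMap_self_apply, zero_sub] at h2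
  rw [h3] at h2
  -- no root vanishes
  have hne : ∀ σ ∈ G.roots, σ ≠ 0 := by
    intro σ hσ hσ0
    rw [Polynomial.mem_roots hG0, Polynomial.IsRoot.def, hσ0, ← Polynomial.coeff_zero_eq_eval_zero, h0] at hσ
    exact one_ne_zero hσ
  have hfac : (G.roots.map fun σ => ℓ - algebraMap ℂ R σ) =
      G.roots.map (fun σ => algebraMap ℂ R (-σ) * (1 - algebraMap ℂ R σ⁻¹ * ℓ)) := by
    refine Multiset.map_congr rfl fun σ hσ => ?_
    rw [mul_sub, mul_one, ← mul_assoc, ← map_mul, neg_mul, mul_inv_cancel₀ (hne σ hσ), map_neg, map_neg,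
      map_one]
    ring
  rw [h1, hfac, Multiset.prod_map_mul, ← mul_assoc]
  have hprod : (G.roots.map fun σ => algebraMap ℂ R (-σ)).prod =
      algebraMap ℂ R ((G.roots.map fun σ => -σ).prod) := by
    rw [map_multiset_prod, Multiset.map_map]
    rfl
  rw [hprod, ← map_mul, ← h2, map_one, one_mul]

/-! ### The truncated exponential of a term `a X^v` is a product of at most `m` binomials -/

/-- The univariate polynomial `G = Σ_{e ≤ m} (α^e a^e / e!) X^e` of `truncExp_eq_aeval` (with `e₀ = 1`) has
constant term `1`. -/
theorem coeff_zero_truncExp (m : ℕ) (α a : ℂ) :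
    (∑ e ∈ Finset.range (m + 1), Polynomial.C ((((e.factorial : ℕ) : ℂ)⁻¹) * α ^ e * a ^ e) *
        Polynomial.X ^ (1 * e)).coeff 0 = 1 := by
  rw [Polynomial.finsetSum_coeff]
  simp_rw [Polynomial.coeff_C_mul_X_pow]
  simp [Finset.sum_ite_eq]

/-- **Splitting of one truncated-exponential factor**: for `α, a ∈ ℂ` and an exponent `v`, the factor
`E_m(α · a X^v) = Σ_{e ≤ m} (α^e / e!) (a X^v)^e` of Saxena's duality is a product of at most `m` binomials
`1 - ρ X^v` (GKKS TR13-026 Lemma 4.7 applied to a single term). -/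
theorem truncExp_factor (m : ℕ) (α a : ℂ) (v : Fin 2 →₀ ℕ) :
    ∃ L : List (ℂ × (Fin 2 →₀ ℕ)), L.length ≤ m ∧
      (∑ e ∈ Finset.range (m + 1),
          algebraMap ℂ (MvPolynomial (Fin 2) ℂ) ((((e.factorial : ℕ) : ℂ)⁻¹) * α ^ e) *
            (algebraMap ℂ (MvPolynomial (Fin 2) ℂ) a * (monomial v (1 : ℂ)) ^ 1) ^ e) =
        (L.map fun p => (1 - C p.1 * monomial p.2 (1 : ℂ))).prod := by
  rw [truncExp_eq_aeval]
  set G : Polynomial ℂ := ∑ e ∈ Finset.range (m + 1),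
    Polynomial.C ((((e.factorial : ℕ) : ℂ)⁻¹) * α ^ e * a ^ e) * Polynomial.X ^ (1 * e) with hG
  have h0 : G.coeff 0 = 1 := coeff_zero_truncExp m α a
  have hdeg : G.natDegree ≤ 1 * m := natDegree_truncExp_le m 1 α a
  obtain ⟨hprod, hcard⟩ := aeval_eq_prod_one_sub G h0 (monomial v (1 : ℂ))
  refine ⟨G.roots.toList.map fun σ => (σ⁻¹, v), ?_, ?_⟩
  · rw [List.length_map, Multiset.length_toList, hcard]
    omega
  · rw [hprod, List.map_map, ← Multiset.prod_map_toList, MvPolynomial.algebraMap_eq]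
    rfl

/-! ### Bookkeeping: products and padding of binomial lists -/

/-- A finite product of polynomials, each a product of at most `m` binomials, is a product of at most
`#s · m` binomials. -/
theorem exists_list_prod {α : Type*} (s : Finset α) (P : α → MvPolynomial (Fin 2) ℂ) (m : ℕ)
    (hP : ∀ v ∈ s, ∃ L : List (ℂ × (Fin 2 →₀ ℕ)), L.length ≤ m ∧
      P v = (L.map fun p => (1 - C p.1 * monomial p.2 (1 : ℂ))).prod) :
    ∃ L : List (ℂ × (Fin 2 →₀ ℕ)), L.length ≤ s.card * m ∧
      ∏ v ∈ s, P v = (L.map fun p => (1 - C p.1 * monomial p.2 (1 : ℂ))).prod := by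
  classical
  induction s using Finset.induction_on with
  | empty => exact ⟨[], by simp, by simp⟩
  | insert a s ha ih =>
    obtain ⟨L₁, hL₁, h₁⟩ := hP a (Finset.mem_insert_self a s)
    obtain ⟨L₂, hL₂, h₂⟩ := ih fun v hv => hP v (Finset.mem_insert_of_mem hv)
    refine ⟨L₁ ++ L₂, ?_, ?_⟩
    · rw [List.length_append, Finset.card_insert_of_notMem ha, Nat.succ_mul]
      omega
    · rw [Finset.prod_insert ha, h₁, h₂, List.map_append, List.prod_append]

/-- Padding: a product of at most `N` binomials is a product of exactly `N` binomials indexed by `Fin N`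
(the missing factors are `1 - 0 · X^0 = 1`). -/
theorem exists_fin_prod (L : List (ℂ × (Fin 2 →₀ ℕ))) (N : ℕ) (hL : L.length ≤ N) :
    ∃ (ρ : Fin N → ℂ) (d : Fin N → (Fin 2 →₀ ℕ)),
      (L.map fun p => (1 - C p.1 * monomial p.2 (1 : ℂ))).prod =
        ∏ j : Fin N, (1 - C (ρ j) * monomial (d j) (1 : ℂ)) := by
  -- pad with `(0, 0)`
  set L' := L ++ List.replicate (N - L.length) ((0 : ℂ), (0 : Fin 2 →₀ ℕ)) with hL'
  have hlen : L'.length = N := by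
    rw [hL', List.length_append, List.length_replicate]
    omega
  have hprod : (L'.map fun p => (1 - C p.1 * monomial p.2 (1 : ℂ))).prod =
      (L.map fun p => (1 - C p.1 * monomial p.2 (1 : ℂ))).prod := by
    rw [hL', List.map_append, List.prod_append, List.map_replicate, List.prod_replicate]
    simp
  rw [← hprod]
  clear_value L'
  subst hlen
  exact ⟨fun j => (L'[j.1]).1, fun j => (L'[j.1]).2,
    (Fin.prod_univ_fun_getElem L' fun p => (1 - C p.1 * monomial p.2 (1 : ℂ))).symm⟩

/-! ### The binomial normal form of one power -/

/-- **Binomial normal form of a power** (GKKS TR13-026 Lemmas 4.6–4.7 applied to the terms of a sparse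
polynomial): if `#supp g ≤ t` then `g^m = Σ_{u ≤ m t} β_u Π_{j < t m} (1 - ρ_{uj} X^{d_{uj}})` for suitable scalars
`β_u, ρ_{uj} ∈ ℂ` and exponents `d_{uj} ∈ ℕ²`. -/
theorem power_normal_form (m t : ℕ) (g : MvPolynomial (Fin 2) ℂ) (hg : g.support.card ≤ t) :
    ∃ (β : Fin (m * t + 1) → ℂ) (ρ : Fin (m * t + 1) → Fin (t * m) → ℂ)
      (d : Fin (m * t + 1) → Fin (t * m) → (Fin 2 →₀ ℕ)),
      g ^ m = ∑ u, C (β u) * ∏ j, (1 - C (ρ u j) * monomial (d u j) (1 : ℂ)) := by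
  classical
  obtain ⟨β, hβ⟩ := exists_dual_weights (K := ℂ) (m * t) m
  have hN : Fintype.card ↥g.support * m ≤ m * t := by
    rw [Fintype.card_coe, mul_comm]
    exact Nat.mul_le_mul_left m hg
  have hdual := duality (K := ℂ) (R := MvPolynomial (Fin 2) ℂ) hN hβ
    (fun v : ↥g.support => algebraMap ℂ (MvPolynomial (Fin 2) ℂ) (coeff v.1 g) * (monomial v.1 (1 : ℂ)) ^ 1)
  have hy : (∑ v : ↥g.support,
      algebraMap ℂ (MvPolynomial (Fin 2) ℂ) (coeff v.1 g) * (monomial v.1 (1 : ℂ)) ^ 1) = g := by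
    simp only [pow_one, MvPolynomial.algebraMap_eq, C_mul_monomial, mul_one]
    rw [Finset.sum_coe_sort g.support (fun v => monomial v (coeff v g))]
    exact g.as_sum.symm
  rw [hy] at hdual
  -- each product over `supp g` is a product of exactly `t m` binomials
  have hfac : ∀ u : Fin (m * t + 1), ∃ (ρ : Fin (t * m) → ℂ) (d : Fin (t * m) → (Fin 2 →₀ ℕ)),
      ∏ v : ↥g.support, (∑ e ∈ Finset.range (m + 1),
        algebraMap ℂ (MvPolynomial (Fin 2) ℂ) ((((e.factorial : ℕ) : ℂ)⁻¹) * ((u : ℕ) : ℂ) ^ e) *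
          (algebraMap ℂ (MvPolynomial (Fin 2) ℂ) (coeff v.1 g) * (monomial v.1 (1 : ℂ)) ^ 1) ^ e) =
        ∏ j, (1 - C (ρ j) * monomial (d j) (1 : ℂ)) := by
    intro u
    obtain ⟨L, hL, hprod⟩ := exists_list_prod (Finset.univ : Finset ↥g.support) _ m
      fun v _ => truncExp_factor m ((u : ℕ) : ℂ) (coeff v.1 g) v.1
    have hL' : L.length ≤ t * m :=
      hL.trans (by rw [Finset.card_univ, Fintype.card_coe]; exact Nat.mul_le_mul_right m hg)
    obtain ⟨ρ, d, h⟩ := exists_fin_prod L (t * m) hL'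
    exact ⟨ρ, d, hprod.trans h⟩
  choose ρ d hρd using hfac
  refine ⟨β, ρ, d, ?_⟩
  rw [← hdual]
  refine Finset.sum_congr rfl fun u _ => ?_
  rw [hρd u, MvPolynomial.algebraMap_eq]

/-! ### Arithmetic -/

/-- `k (m t + 1) · t m + 2 ≤ 4^m (k t + 2)^2`. -/
theorem count_le (k m t : ℕ) : k * (m * t + 1) * (t * m) + 2 ≤ 2 ^ (2 * m) * (k * t + 2) ^ 2 := by
  have hm : m ≤ 2 ^ m := (Nat.lt_two_pow_self).le
  have hP : 1 ≤ 2 ^ m := Nat.one_le_two_pow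
  have hk : k ≤ k * k := Nat.le_mul_self k
  have h1 : k * m ^ 2 * t ^ 2 ≤ (2 ^ m) ^ 2 * k ^ 2 * t ^ 2 := by
    have : k * m ^ 2 ≤ (2 ^ m) ^ 2 * k ^ 2 := by
      calc k * m ^ 2 ≤ (k * k) * (2 ^ m) ^ 2 := Nat.mul_le_mul hk (Nat.pow_le_pow_left hm 2)
        _ = (2 ^ m) ^ 2 * k ^ 2 := by ring
    exact Nat.mul_le_mul_right _ this
  have h2 : k * m * t ≤ (2 ^ m) ^ 2 * (4 * k * t) := by
    have : m ≤ (2 ^ m) ^ 2 * 4 := by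
      calc m ≤ 2 ^ m := hm
        _ ≤ 2 ^ m * (2 ^ m * 4) := Nat.le_mul_of_pos_right _ (by positivity)
        _ = (2 ^ m) ^ 2 * 4 := by ring
    calc k * m * t = m * (k * t) := by ring
      _ ≤ ((2 ^ m) ^ 2 * 4) * (k * t) := Nat.mul_le_mul_right _ this
      _ = (2 ^ m) ^ 2 * (4 * k * t) := by ring
  have h3 : 2 ≤ (2 ^ m) ^ 2 * 4 := by nlinarith
  calc k * (m * t + 1) * (t * m) + 2 = k * m ^ 2 * t ^ 2 + k * m * t + 2 := by ring
    _ ≤ (2 ^ m) ^ 2 * k ^ 2 * t ^ 2 + (2 ^ m) ^ 2 * (4 * k * t) + (2 ^ m) ^ 2 * 4 := by omega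
    _ = 2 ^ (2 * m) * (k * t + 2) ^ 2 := by ring

/-- The final exponent bookkeeping: `(k (m t + 1) t m + 2)^b ≤ 2^{2 b m} (k t + 2)^{2 b}`. -/
theorem count_pow_le (b k m t : ℕ) :
    (k * (m * t + 1) * (t * m) + 2) ^ b ≤ 2 ^ (2 * b * m) * (k * t + 2) ^ (2 * b) := by
  calc (k * (m * t + 1) * (t * m) + 2) ^ b ≤ (2 ^ (2 * m) * (k * t + 2) ^ 2) ^ b :=
        Nat.pow_le_pow_left (count_le k m t) b
    _ = 2 ^ (2 * b * m) * (k * t + 2) ^ (2 * b) := by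
        rw [mul_pow, ← pow_mul, ← pow_mul, show 2 * m * b = 2 * b * m by ring]

end BinomialStep

/-- STUB `stub_binomialStep` of line `binomial-normal-form` — **duality + splitting step**: a binomial bound with
exponent `b` (for ALL numbers `K` of products and `N` of binomial factors `1 - ρ X^d`, `ρ = 0` allowed) gives the
powers bound with constants `(2b, 2b)`: `vert(Σ_{i<k} c_i g_i^m) ≤ 2^{2 b m} (k t + 2)^{2 b}` for `t`-sparse `g_i`.
Proof: each `c_i g_i^m` is a sum of `m t + 1` scalar multiples of products of exactly `t m` binomials
(`BinomialStep.power_normal_form`, GKKS TR13-026 Lemmas 4.6–4.7), so the whole sum is an instance of the hypothesis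
with `K = k (m t + 1)`, `N = t m`, and `k (m t + 1) t m + 2 ≤ 4^m (k t + 2)^2`. -/
theorem stub_binomialStep (b : ℕ)
    (h : ∀ (K N : ℕ) (c : Fin K → ℂ) (ρ : Fin K → Fin N → ℂ) (d : Fin K → Fin N → (Fin 2 →₀ ℕ)),
      vert (∑ l, C (c l) * ∏ j, (1 - C (ρ l j) * monomial (d l j) 1)) ≤ (K * N + 2) ^ b)
    (k m t : ℕ) (c : Fin k → ℂ) (g : Fin k → MvPolynomial (Fin 2) ℂ) (hg : ∀ i, (g i).support.card ≤ t) :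
    vert (∑ i, C (c i) * g i ^ m) ≤ 2 ^ (2 * b * m) * (k * t + 2) ^ (2 * b) := by
  choose β ρ d hrepr using fun i => BinomialStep.power_normal_form m t (g i) (hg i)
  -- re-index the `k (m t + 1)` products by `Fin (k (m t + 1))`
  set e := (finProdFinEquiv : Fin k × Fin (m * t + 1) ≃ Fin (k * (m * t + 1))) with he
  have hsum : ∑ i, C (c i) * g i ^ m =
      ∑ l : Fin (k * (m * t + 1)), C (c (e.symm l).1 * β (e.symm l).1 (e.symm l).2) *
        ∏ j, (1 - C (ρ (e.symm l).1 (e.symm l).2 j) * monomial (d (e.symm l).1 (e.symm l).2 j) (1 : ℂ)) := by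
    have hi : ∀ i, C (c i) * g i ^ m =
        ∑ u, C (c i * β i u) * ∏ j, (1 - C (ρ i u j) * monomial (d i u j) (1 : ℂ)) := by
      intro i
      rw [hrepr i, Finset.mul_sum]
      refine Finset.sum_congr rfl fun u _ => ?_
      rw [C_mul, mul_assoc]
    simp_rw [hi]
    rw [← Fintype.sum_prod_type']
    exact Fintype.sum_equiv e _ _ fun p => by simp only [Equiv.symm_apply_apply]
  rw [hsum]
  exact (h _ _ _ _ _).trans (BinomialStep.count_pow_le b k m t)

end Summit.ValiantsHypothesis.ValiantsHypothesis.Theorems.NewtonUnitEquationsNewtonTauWeak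

end
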